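import Mathlib
import HarnessLib
import HarnessLib.Audit
import Summits.AtomisticToContinuum.Statement
import Literature.MathematicalPhysics.KineticTheory.CellChain
import Literature.MathematicalPhysics.KineticTheory.HarmonicHostWithCell
import Summits.AtomisticToContinuum.FouriersLaw.Theorems.EmbeddedDrudeMourreNessUnique
import Summits.AtomisticToContinuum.FouriersLaw.Theorems.FourierGreenKuboFourierFiniteResponseOfUnique
import Summits.AtomisticToContinuum.FouriersLaw.Theorems.ContactEchoEpochsPinnedSteadyStateExists
import HarnessLib.Audit.Status.Attr

/-!
Route: PhononLorentzGas

Conforming (D-0027 §2.1) re-opening of the idea card dilute-nonlinearity-phonon-lorentz-gas (spine;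
gen-1 route DilutePhononLorentzGas
was retired only because its assembly named the Literature decl instead of the Statement decl). Make
the nonlinearity DILUTE instead of weak:
the cell chains P_ℓ = cellChain ω₂ lam β γ (cellPeriodic ℓ) carry the conjunct's quartic terms (lam
q⁴/4 on site, β r⁴/4 on the right bond)
on every ℓ-th site of the ω₂-pinned unit-coupling harmonic host between the same Langevin baths; the
dense member cellChain … (fun _ => true)
= cellChain … (cellPeriodic 1) IS (pinnedChain ω₂ lam β γ).toSiteChain (cellChain_const_true, rfl;
cellChain_cellPeriodic_one).
It suffices to show X = X_rung ∧ X_cmp together with the shared frame (U) NessUnique, (F)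
FiniteResponseOfUnique, (L) PositiveOrInfiniteLimit,
(E) PinnedSteadyStateExists:
X_rung (crux DiluteBoundedResponse): at every T > 0, for all ℓ ≥ ℓ₀(T) the dilute chain P_ℓ has, for
N large, response coefficients
D_N(P_ℓ,T) and all of them are bounded by C(T,ℓ) — Ohmic (non-anomalous) conduction of a
deterministic Hamiltonian-bulk chain, obtained
in the kinetic window by RENEWAL over visits to cells that MIX (crux CellMixing: one conjunct cell
in the thermal harmonic lattice field on ℤ
is mixing) faster than phonons return (2ℓ/v_max), i.e. a phonon Lorentz gas with the cells as
Hamiltonian Büttiker probes;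
X_cmp (crux DilutionComparison): at every T > 0, for all ℓ ≥ ℓ₁(T) and N large, every response
coefficient of the dense chain P_1 is
≤ every response coefficient of P_ℓ (sufficiently dilute periodic dilutions conduct at least as
well).
X_rung + X_cmp give an eventual upper bound on D_N of pinnedChain along the canonical steady-state
family; (L) gives D_N → ℓ ∈ (0,+∞] in
EReal, hence ℓ ≤ C is real and positive =: κ(T); (U) makes κ family-independent and, with (E) —
clause-(i) existence of a weak steady state
of pinnedChain at every N, T_L, T_R > 0, which is the in-tree theorem
pinnedChain_exists_isSteadyState (Cuneo–Eckmann–Hairer–Rey-Bellet 2018,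
proved) carried as a provable-now support item since the cone repair (rev 1) so that this file
imports no Langevin-SDE module — gives
clause (i); (F) supplies the response limits.
Lean: `DiluteBoundedResponse ∧ DilutionComparison ∧ NessUnique ∧ FiniteResponseOfUnique ∧
PositiveOrInfiniteLimit ∧ PinnedSteadyStateExists`
(decls of this route; each is the one-line Prop below, all elaborated in the planner's Sketch.lean
with imports CellChain +
HarmonicHostWithCell only, lean check rc 0, where `theorem closes` is proved from exactly these six)

## Assembly
The deciding theorem `theorem closes (hDil : DiluteBoundedResponse) (hCmp : DilutionComparison) (hU
: NessUnique)
(hR : FiniteResponseOfUnique) (hL : PositiveOrInfiniteLimit) (hE : PinnedSteadyStateExists) :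
_root_.FouriersLaw` is PROVED in the
planner folder (glue.lean = the theorem alone; Sketch.lean with all items, lean check rc 0, axioms
propext / Classical.choice /
Quot.sound). Proof: Step 0 = the glue DiluteToDense inlined (bounded response of the dense chain);
clause (i) from the hypothesis
PinnedSteadyStateExists (all N; = pinnedChain_exists_isSteadyState, i.e.
CuneoEckmannHairerReyBellet2018_pinnedChain_holds for N ≥ 1 and
the point mass for N = 0) + NessUnique; clause (ii): along the canonical family (Classical.choose of
the unique steady states)
FiniteResponseOfUnique gives D_N, PositiveOrInfiniteLimit an EReal limit ℓ > 0, Step 0 forces ℓ ≤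
sup|D_N| < ⊤, so
κ(T) := ℓ.toReal > 0 and D_N → κ(T); uniqueness transfers the δ-limits to every steady-state family
(Filter.Tendsto.congr' for |δ| < 2T).
Rev 0's `closes` had five hypotheses and called pinnedChain_exists_isSteadyState directly (import
LangevinChainNESSHolds); rev 1 (cone
repair 2026-08-15) takes it as the sixth hypothesis instead, nothing else changed.
CellMixing and CellDynamicsExists are the analytic input of the rung (layer 2) and the cheapest
decisive test of the whole line; they are
items, not hypotheses of `closes`.

Rationale: WHY THIS LINE. The conjunct has no small parameter and both perturbative corners are catalogued dead
ends (harmonic point ballistic; weak anharmonicity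
degenerates as (λT)⁻²); the card's move is to thin the SUPPORT of an O(1) nonlinearity (small
parameter 1/ℓ, geometric), so that the refuted
harmonic crystal becomes the free flight of a Lorentz gas of phonons and each quartic cell a
deterministic thermal scatterer (Gallavotti1969,
Spohn1978 and, for waves, the low-density limit doi:10.1142/s0129055x0500242x transplanted with the
dictionary dilute random scatterers ↦
dilute deterministic-but-thermal cells, Boltzmann–Grad window ↦ ℓ ≫ cell mixing time × v_max;
dephasing probes ⇒ series law, Buttiker1986,
BonettoLebowitzLukkarinen2004, Dhar2008 §3.5, here DERIVED from cell mixing instead of postulated).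
Imported areas: kinetic/low-density
limits and renewal theory (probability), return to equilibrium of a finite nonlinear system in an
infinite linear field (JaksicPillet1998 for
the continuum field, doi:10.1007/s00205-006-0039-z Komech–Komech for one nonlinear oscillator in the
Klein–Gordon field, the linear lattice
impurity doi:10.1016/0031-8914(71)90068-1 Cukier–Mazur, the lattice probe arXiv:2510.20003),
scattering by nonlinear defects. What is new
relative to gen-1 and to the sibling dilute routes (GaussianiserCellTransfer: CLT +
transfer-operator gap; MatthiessenIncrements: prefix-ladder
increments): all three cruxes are now TYPED over the landed definitions CellChain /
HarmonicHostWithCell; the densification step is the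
corrected DilutionComparison (gen-1's monotonicity in arbitrary cell sets is false at high T, see
Numbers) and it is load-bearing in a
PROVED deciding theorem; the limit engine is the shared import slot PositiveOrInfiniteLimit
(stmt-9128), so the line supplies exactly the
missing upper bound ('dependence of D on L', BLR2000 §6.3) and nothing it cannot.

RANKED CRUXES. #2 CellMixing (crux) — ONE CONJUNCT CELL IN THE THERMAL HARMONIC LATTICE FIELD IS
MIXING (card crux CellMixing; shared in substance with GaussianiserCellTransfer's SingleCellMixing):
for ω₂, lam, β > 0 and T > 0, for the infinite chain harmonicHostWithCell ω₂ lam β {0} on ℤ (pinning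
ω₂ q²/2 and unit harmonic bonds everywhere, plus lam q₀⁴/4 at site 0 and β (q₁ − q₀)⁴/4 on the bond
(0,1)), every infinite-volume dynamics D preserving a TEMPERED (uniformly bounded second moments)
Gibbs state μ at temperature T has decaying time correlations ⟨F ; G∘Φ_t⟩_μ → 0 for all smooth local
observables of polynomial growth in every finite window Λ. [difficulty: XL] (why it might fail: Hard
quartic cell: large-amplitude states oscillate above the band top √(ω₂+4) with all harmonics and
combination tones off the BOUNDED band, so exact breathers exist and Komech-type spectral spreading
(unbounded continuum) is unavailable; a positive-measure sticky set kills mixing.)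
[JaksicPillet1998, doi:10.1007/s00205-006-0039-z, doi:10.1016/0031-8914(71)90068-1,
arXiv:2510.20003, HairerMattingly2009, LanfordLebowitzLieb1977]
#3 DilutionComparison (crux) — SUFFICIENTLY DILUTE PERIODIC DILUTIONS OF THE CONJUNCT CHAIN CONDUCT
AT LEAST AS WELL (the densification step, corrected from gen-1's CellMonotonicity): for all ω₂, lam,
β, γ > 0 and T > 0 there is ℓ₁ such that for every ℓ ≥ ℓ₁ there is N₀ with: for N ≥ N₀, every
finite-N response coefficient D of the dense chain cellChain ω₂ lam β γ (fun _ => true) (=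
pinnedChain ω₂ lam β γ, rfl) at temperature T and every response coefficient D' of the dilute chain
P_ℓ = cellChain ω₂ lam β γ (cellPeriodic ℓ) at the same N, T satisfy D ≤ D'. As N → ∞ it says κ(T) ≤
κ_ℓ(T) for ℓ ≥ ℓ₁(T), which the kinetic picture predicts with room to spare (κ_ℓ ≈ ℓ/r₁(T) → ∞);
only the pair (dense, P_ℓ) with ℓ large is claimed — no monotonicity in general cell sets, no fixed
ℓ. [difficulty: open-problem] (why it might fail: No comparison principle for NESS currents of
deterministic chains is known; the claim is false for small ℓ at high T (dense κ ~ T^(1/4) vs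
weak-link P_ℓ), hence ℓ₁(T); a proof by series decomposition at the shared cells presupposes that
cells thermalise inside the DENSE chain too.) [Buttiker1986, BonettoLebowitzLukkarinen2004,
DharLebowitz2008, Dhar2008, BonettoLebowitzReyBellet2000]
#4 DiluteBoundedResponse (crux) — THE RUNG — PERIODIC DILUTE CELL CHAINS HAVE A WELL-DEFINED,
N-UNIFORMLY BOUNDED RESPONSE (card items DiluteMarkovLimit + 'beyond the window'): for all ω₂, lam,
β, γ > 0 and T > 0 there is ℓ₀ such that for every ℓ ≥ ℓ₀ there are C and N₀ with: for all N ≥ N₀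
the chain P_ℓ = cellChain ω₂ lam β γ (cellPeriodic ℓ) HAS a response coefficient at (N, T) (some
weak-steady-state family over the bath temperatures with a δ-limit of the total current:
Cuneo–Eckmann–Hairer–Rey-Bellet existence for the path network swept from the right bath +
Hairer–Majda linear response, folded in) and EVERY response coefficient D at (N, T) satisfies |D| ≤
C (expected D ≈ ℓ/r₁(T)·(1+o(1)), r₁ = (1−τ)/(τ c_∞) the single-cell excess resistance). [deps:
CellMixing] [difficulty: XL] (why it might fail: Inside the kinetic window (M ≤ M_T(ℓ) cells) it is
a renewal theorem; for fixed ℓ and N → ∞ the residual inter-cell memory after the return time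
2ℓ/v_max must not accumulate, band-edge tails of the lattice field decay only like t^(-1/2), and
ℓ₀(T) → ∞ both as T → 0 and T → ∞.) [Gallavotti1969, Spohn1978, doi:10.1142/s0129055x0500242x,
BricmontKupiainen2013, CuneoEckmannHairerReyBellet2018, HairerMajda2009, arXiv:2510.20003]
#9 CellDynamicsExists (support) — de-vacuifies CellMixing: for ω₂, lam, β > 0 and T > 0 the one-cell
chain harmonicHostWithCell ω₂ lam β {0} has a tempered Gibbs state at temperature T (uniformly
bounded second moments) carried by an infinite-volume dynamics that preserves it
(Lanford–Lebowitz–Lieb 1977 Thm 3 for the site-dependent nearest-neighbour chain — printed in that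
generality, proved in tree only for homogeneous chains — plus Thm 4 uniqueness in dimension one and
invariance of the Gibbs state). [difficulty: L] [LanfordLebowitzLieb1977, arXiv:2510.20003]
#9 NessUnique (support) — SHARED (stmt-AtomisticToContinuum-0741; FourierGreenKubo,
BondHeatUncertainty, …): for pinnedChain ω₂ lam β γ (all > 0), every N and T_L, T_R > 0, weak steady
states (IsSteadyState: probability, ∫ L f dμ = 0 on C_c^∞, bond currents integrable) are unique;
with the proved existence theorem it is clause (i) of FouriersLawFor and it collapses the family
quantifiers of clause (ii). [difficulty: M] [CuneoEckmannHairerReyBellet2018, Carmona2007]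
#9 FiniteResponseOfUnique (support) — SHARED (stmt-AtomisticToContinuum-0717): under weak-NESS
uniqueness the finite-N linear-response limit D_N(T) = lim_(δ→0, δ≠0)
totalCurrent(μ_(N,T+δ/2,T−δ/2))/δ of pinnedChain exists for every steady-state family, T > 0 and N
(finite-volume Green–Kubo / Hairer–Majda linear response). [difficulty: M] [ReyBellet2003,
HairerMajda2009, CuneoEckmannHairerReyBellet2018]
#9 PositiveOrInfiniteLimit (support) — SHARED IMPORT SLOT (stmt-AtomisticToContinuum-9128,
BondHeatUncertainty; what THIS line does not supply: the lower bound and the existence of the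
limit): under weak-NESS uniqueness, along every steady-state family and every T > 0 the response
coefficients D_N converge in EReal to some ℓ ∈ (0, +∞]. Necessary for the conjunct; suppliers are
the series-law lines (Fekete / superadditive-junction / escape-deficit cards). Provers of THIS route
should not start here. [difficulty: L] [BonettoLebowitzReyBellet2000, Hammersley1988,
CanestrariLiveraniOlla2026]
#9 BoundedResponse (support) — SHARED OUTPUT NODE (stmt-AtomisticToContinuum-11071, the catalogued
waypoint 'dependence of D on L' written out without the Barriers predicate): along every
steady-state family of pinnedChain ω₂ lam β γ (all > 0) and every T > 0, if the response limits D_N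
exist for all N then (|D_N|)_N is bounded. In THIS route it is the OUTPUT of the ladder (item
DiluteToDense, proved by the planner); the deciding theorem re-derives it inline. [difficulty:
open-problem] [BonettoLebowitzReyBellet2000, BonettoLebowitzLukkarinenOlla2009]
#9 DiluteToDense (support) — GLUE OF THE LADDER, PROVED sorry-free by the planner (Sketch.lean
`diluteToDense_holds`, axioms propext / Classical.choice / Quot.sound; ~45 lines, copy into
Theorems/): DiluteBoundedResponse → DilutionComparison → NessUnique → PositiveOrInfiniteLimit →
BoundedResponse (the fourth hypothesis is the statement of item PositiveOrInfiniteLimit written out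
verbatim, so that the decl elaborates wherever the gate renders it). Proof: each D N of a
steady-state family of pinnedChain is a response coefficient of cellChain … (fun _ => true) by rfl;
with ℓ = max(ℓ₀, ℓ₁) the comparison and the rung give D N ≤ D' ≤ C for N ≥ max(N₀, N₀'); the slot
gives D N → ℓ > 0 in EReal, so D N ≥ 0 eventually; finitely many N are absorbed by a finite sum.
[difficulty: provable-now] [BonettoLebowitzReyBellet2000]
#9 PinnedSteadyStateExists (support) — SHARED (stmt-AtomisticToContinuum-9900; FeketeSeriesLaw,
HeatModeWeylLaw, ScaleFreeAnchor, …), CLAUSE-(i) EXISTENCE carried as an item since the cone repair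
(rev 1, 2026-08-15): for pinnedChain ω₂ lam β γ (all > 0), every N and all T_L, T_R > 0 there is a
weak steady state (IsSteadyState). PROVED in tree as
Literature.MathematicalPhysics.KineticTheory.HeatConduction.pinnedChain_exists_isSteadyState
(LangevinChainNESSHolds.lean: CuneoEckmannHairerReyBellet2018_pinnedChain_holds for N ≥ 1, the point
mass for N = 0); a Theorems file importing this route file + LangevinChainNESSHolds closes it in one
line (planner evidence Evidence.lean `pinnedSteadyStateExists_holds`, lean check rc 0, axioms
propext / Classical.choice / Quot.sound). WHY AN ITEM: `closes` takes it as its sixth hypothesis so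
that the Theses file needs no Langevin-SDE import (see DEFINITION REQUESTS / IMPORTS). [difficulty:
provable-now] [CuneoEckmannHairerReyBellet2018]

TWO-LAYER PLAN. Foreseen glued split of the rung once CellMixing closes (k = 3, depth 1):
DiluteBoundedResponse ⇐ DiluteOhmWindow (the kinetic-window
renewal theorem: |ρ_(Mℓ)(T) − r₀(T) − M·r₁(T)| ≤ εM for ℓ ≥ ℓ₀(ε,T), M ≤ M_T(ℓ) with
M_T(ℓ)²·m_T(2ℓ/v_max) → 0; inputs: a mixing RATE m_T
extracted from CellMixing for cell-energy observables, the Gaussian no-return /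
finite-group-velocity estimate of the harmonic leads, and
the single-cell Landauer datum 0 < τ(T) < 1) → BeyondWindow (for fixed ℓ ≥ ℓ₀ the resistance of P_ℓ
stays ≥ c(T,ℓ)·(number of cells) as
N → ∞: only a LOWER bound on resistance is needed) → DiluteNessResponse (steady states for all bath
temperatures and δ-limits for P_ℓ:
CEHR network existence + Hairer–Majda) → DiluteBoundedResponse. CellMixing ⇐ NoStickyBreathers (no
positive-Gibbs-measure flow-invariant
set of cell-localised states; every above-band periodic or quasi-periodic cell orbit is measure
zero) → L²-mixing given that. No split of
DilutionComparison is foreseen by this line (its natural children — a series law at thermalising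
cells of the dense chain — belong to the
densification cards).

KILL CRITERIA. CellMixing refuted by a positive-measure non-mixing set (sticky breather islands of
the hard quartic cell at some T) closes the route
outright (close --reason refuted:CellMixing): no dephasing, no renewal — and it is decisive negative
knowledge for all three dilute-cell
cards; refuted only through NON-UNIQUENESS of tempered Gibbs states (a mixture is never mixing) ⇒
restate for extremal states, once.
DilutionComparison refuted for the pair (dense, P_ℓ) at arbitrarily large ℓ (certified numerics
admissible for a pivot, a theorem closes)
kills the route's claim on the conjunct: close refuted:DilutionComparison and hand the rung to
GaussianiserCellTransfer / the Matthiessen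
card as a Literature-value target. DiluteBoundedResponse refuted (super-diffusion of periodic dilute
chains at all large ℓ) closes the
route and is itself a major negative result on deterministic dephasing. PositiveOrInfiniteLimit is
an import slot: its refutation refutes
the conjunct (then ¬FouriersLaw is filed by whoever holds the witness). BoundedResponse proved
elsewhere moots DilutionComparison for the
conjunct but leaves the rung and CellMixing as stand-alone theorems (release, do not close).

NOT DECOMPOSED YET. The renewal theorem in the window, the single-cell Landauer datum τ(T) ∈ (0,1)
and its Lean object (half-infinite harmonic leads or their
Rubin/GLE reduction), the no-return estimate (v_max = max_k |ω′(k)|, ω(k)² = ω₂ + 4 sin²(k/2)), the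
beyond-window stability, any mixing
RATE (qualitative mixing only is filed: integrable decay of all local correlations is false already
for the host's band-edge t^(-1/2)
tails), the T-dependence of ℓ₀, ℓ₁ and of every constant (allowed to blow up as T → 0 and T → ∞),
uniqueness of the dilute chains' steady
states (not needed: the rung quantifies over all response coefficients), and the whole mechanism of
DilutionComparison. No definition is
requested: CellChain.lean and HarmonicHostWithCell.lean (landed for gen-1 / the sibling route) type
everything.

CHEAPEST FALSIFIER. kit MD (not run: compute-free hub, one-shot plancard seat) at (ω₂, lam, β, γ) =
(1,1,1,1): (i) T = 1, cell chains P_ℓ, ℓ ∈ {4, 8, 16},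
N = Mℓ, M ∈ {4,…,64}, small δT: is R_N = (N−1)/D_N affine in M with a slope r₁(ℓ) that saturates in
ℓ? sub-linear growth or non-saturation
kills the rung cheaply; (ii) DilutionComparison at T ∈ {0.3, 1, 10}: compare D_N(dense) with
D_N(P_ℓ) for ℓ ∈ {2, 4, 8, 16},
N ∈ {64, 128, 256} — the crux predicts D_N(dense) ≤ D_N(P_ℓ) once ℓ ≥ ℓ₁(T) with ℓ₁ growing in T (at
T = 10 the inequality SHOULD fail for
ℓ = 2: that failure is the planner's own prediction, not a refutation); a reproducible D_N(dense) >
D_N(P_ℓ) persisting as ℓ doubles at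
fixed T retires the crux; (iii) one cell in a long harmonic chain (N = 2048, equal bath
temperatures): does the cell-energy
autocorrelation decay, or is there a plateau of weight ≈ e^(−E*/T) (breather trapping)? Analytic
check anyone can do on paper: exhibit the
exact above-band breather family of the single hard-quartic site in the infinite linear chain
(rotating-wave + continuation) and verify
that no multiple of its frequency meets the band — it fixes the rate discussion of CellMixing but
does not refute it.

NUMBERS. Host band ω(k)² = ω₂ + 4 sin²(k/2), group velocity ≤ 1/√ω₂ … v_max = max_k |sin k|/ω(k);
local correlations of the host decay like t^(-1/2)
(stationary phase at k = 0, π). Ballistic coefficient of the host c_∞(ω₂, γ) = γ r/(2(1+γ²)) > 0,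
D_N(P_∞-segment) = (N−1) c_N
(HarmonicChainBallisticFlux_holds, RoyDhar2008 (2.8)). Single linear stiffness defect δ binds a mode
at Ω² = ω₂ + 2 + √(4 + δ²) above the
band (Montroll–Potts); a hard quartic cell at energy E oscillates at Ω(E) ~ (lam E)^(1/4) with all
odd harmonics above the band.
High-temperature scaling that corrects gen-1: the dense chain is asymptotically the scale-free
quartic chain, κ_dense(T) ≍ κ₀·T^(1/4)
(ScaleFreeQuarticAnchor / PorousMediumCorner routes), while in P_ℓ (ℓ ≥ 2) at T → ∞ the harmonic
bonds carry energy O(T^(1/2)) ≪ T and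
become weak links — in the rescaled variables q = T^(1/4)Q, t = T^(−1/4)s the chain P_ℓ is a De
Roeck–Huveneers chain of anharmonic
(ℓ = 2: dimer) units with WEAK harmonic coupling ε = T^(−1/2), whose rescaled conductivity is o(ε^n)
for every n (DeRoeckHuveneers2015_thm2-type
asymptotic localisation) — so κ_(P_ℓ)(T) = T^(1/4)·o(T^(−n/2)) → 0: hence D_N(dense) > D_N(P_2)
eventually at large T, i.e. monotonicity in
the cell set (gen-1's CellMonotonicity) is false and ℓ₁(T) → ∞ as T → ∞. Kinetic corner: κ(T) ≍ (lam
T)^(−2) as T → 0 (AokiLukkarinenSpohn2006), r₁(T) = O(T²), ℓ₀(T), ℓ₁(T) → ∞ as T → 0.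
Expected window: M_T(ℓ) ≍ m_T(2ℓ/v_max)^(−1/2). Items at open: 10 (3 crux, 6 support, 1 assembly).
After the cone repair (rev 1): 11 (3 crux, 7 support incl. PinnedSteadyStateExists, 1 assembly
restated with six hypotheses); no crux restated.

DEFINITION REQUESTS. None. CellChain.lean (SiteChain, cellChain, cellPeriodic, IsResponseCoeff;
defn-CellChain of gen-1) and HarmonicHostWithCell.lean
(InfiniteChain, harmonicHostWithCell, Dynamics, IsGibbs, PreservesMeasure, HasCorrelationDecay;
defn-HarmonicHostWithCell) have landed and
type every item; no cite fact is requested (the CEHR existence theorem and the harmonic flux are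
PROVED in tree). Later, with the split of
the rung: the half-infinite harmonic lead / thermal transmission τ(T) of one cell
(Literature/MathematicalPhysics/KineticTheory). IMPORTS (route-repair 2026-08-15, cone guardrail,
rev 1): the Theses file imports only Literature.MathematicalPhysics.KineticTheory.CellChain
(SiteChain, cellChain, cellPeriodic, IsResponseCoeff; it re-exports FouriersLaw.lean: pinnedChain,
OscillatorChain.IsSteadyState, totalCurrent, PhaseSpace) and
Literature.MathematicalPhysics.KineticTheory.HarmonicHostWithCell (harmonicHostWithCell, Dynamics,
IsGibbs, PreservesMeasure, HasCorrelationDecay); LangevinChainNESS (redundant — only the CEHR fact,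
which no item names) and LangevinChainNESSHolds (needed only by rev 0's `closes` call of
pinnedChain_exists_isSteadyState, now the item PinnedSteadyStateExists) are DROPPED — project-module
import cone 78 → 24 modules; the eight modules reached through the two planner-chosen imports
(CellChain, FouriersLaw, HarmonicHostWithCell, InfiniteChainDynamics,
Probability/LatticeModels/{GibbsSpecification, IsingModel, LatticeGraph, Correlations}) carry no
named fact without an `X_holds` theorem (LanfordLebowitzLieb1977_thm1_chain_holds /
_thm3_chain_holds, convex_gibbsMeasures_holds, isGibbsMeasure_iff_condExp_holds,
zdGraph_preconnected_holds, …), and the gate's constant-level cone (#h21_route_deps of items +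
closes, 56 constants, planner-run on a copy of the file) contains no unproved closed fact: its
cite-tagged members are predicates with explicit binders (OscillatorChain.IsSteadyState,
SiteChain.IsSteadyState, SiteChain.IsResponseCoeff, InfiniteChain.IsGibbs, InfiniteChain.IsSolution,
IsGibbsMeasure — vocabulary) plus the Statement. Residual import-cone members without an
`X_holds`-named witness are NOT used by any item and are operator-side: the sibling summit
statements HydrodynamicLimit / Crystallization / BoseEinsteinCondensation (imported by
Summits.AtomisticToContinuum.Statement, which the gate renders, and by FouriersLaw/Statement.lean
itself) and the target FouriersLaw; the one Literature fact rev 0 dragged in,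
Literature.Analysis.Distribution.Hormander1967_thm11 (via LangevinChainNESSHolds →
LangevinChainKernelDensity → LangevinChainCostate → LangevinChainHormander → Hypoelliptic), is
PROVED in tree as Literature.Analysis.Hypoelliptic.hormander1967_thm11_proof (a non-`_holds` name,
hence census-unproved) and is no longer in the cone. No fact is genuinely needed as a hypothesis
(needs-fact: none).

Novelty: Searches (2026-08-15, this session, on top of the card's searches and the refuter novelty audit
recorded on the card, and gen-1's):
`ledger negatives --problem AtomisticToContinuum` (6 refuted statements, none in FouriersLaw); `lit
frontier AtomisticToContinuum --since 2020`
(30 rows; relevant: arXiv:2602.07988 hierarchical Lorentz mirror model with normal transport,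
arXiv:2310.13338 heat equation from a
deterministic dynamics, arXiv:2510.20003 probe in a harmonic lattice bath, arXiv:2605.24268
site-dependent α-FPUT, arXiv:2604.00777);
`lit bridges AtomisticToContinuum --cross any` (94 lines, no bridge on impurity scattering or dilute
nonlinearity); `lit search --source
crossref` ×7: "anharmonic impurity harmonic chain heat conduction Fourier law" (8:
doi:10.1103/physrevlett.96.100601,
doi:10.1103/physrevlett.86.5882), "dilute anharmonic defects harmonic lattice heat transport kinetic
limit" (6: doi:10.1615/ihtc17.290-90
Kosevich–Koroleva arrays of nonlinear defects, numerics), "nonlinear oscillator impurity harmonic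
chain return to equilibrium mixing" (7:
doi:10.1016/0031-8914(71)90068-1 Cukier–Mazur 1971, doi:10.1016/0031-8914(72)90054-7 — the LINEAR
impurity is mixing), "Buttiker probe
dephasing … self-consistent reservoirs" (8: doi:10.1103/physrevb.11.2164,
doi:10.1103/physreve.77.062102,
doi:10.1023/b:joss.0000037232.14365.10), "monotonicity thermal conductivity number of anharmonic
sites" (8, none relevant), "nonlinear Lamb
system … Komech" (6: doi:10.1007/s00205-006-00  [refs: 10.1103/physrevlett.96.100601, 10.1103/physrevlett.86.5882, 10.1615/ihtc17.290-90, 10.1016/0031-8914(71, 10.1016/0031-8914(72, 10.1103/physrevb.11.2164, 10.1103/physreve.77.062102, 10.1023/b:joss.0000037232.14365.10, 10.1007/s00205-006-0039-z, 10.1016/j.physleta.2009.01.054, 10.1142/s0129055x0500242x, 2602.07988, 2310.13338, 2510.20003, 2605.24268, 2604.00777, doi:10.1103/physrevlett.96.100601, do]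

Barriers (technique_class: dilute-nonlinearity renewal-limit, dilution-comparison): - technique_class: dilute-nonlinearity renewal-limit, dilution-comparison
- Literature.Barriers.AtomisticToContinuum.HarmonicChainBallisticFlux: used, not fought — the
harmonic segments are the free flights (the proved fact supplies c_∞ and the no-resistance of the
host); every resistance in the line sits at a quartic cell and nothing survives lam = β = 0 at the
cells (r₁ = 0), so it is not an effective-linear-dynamics argument; DilutionComparison compares two
ANHARMONIC chains and is not claimed for the harmonic host (where it is false: P_ℓ conducts worse
than the host).
- Literature.Barriers.AtomisticToContinuum.LowTemperatureWeakAnharmonicity: all statements are at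
fixed T > 0 with T-dependent ℓ₀(T), ℓ₁(T), C; as T → 0 cells linearise (τ → 1, r₁ → 0) and both
thresholds diverge consistently with κ ~ (λT)⁻²; no constant is claimed uniform near the harmonic
corner.
- Literature.Barriers.AtomisticToContinuum.HasBoundedResponse: this is the route's OUTPUT node (item
BoundedResponse, unfolded), reached not by fixed-N NESS analysis with N-uncontrolled constants (the
documented blocked class) but by an N-uniform mechanism on dilute chains (constants depend on T, ℓ
only) plus a comparison between chains of the SAME length; the fixed-N inputs (NessUnique,
FiniteResponseOfUnique) are plumbing.
- Literature.Barriers.AtomisticToContinuum.HairerMattingly2009_threeOscillators: the real danger for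
CellMixing (above-band cell states radiate slowly or not at all); partly evaded as in CEHR

History (route lifecycle, newest last):
- 2026-08-22T13:09:41Z · DORMANT — reconciler: no traction for 5.3 d (last activity item-evidence-added at 2026-08-17T04:08:34Z); parked, not closed — `ledger route dormant route-AtomisticToConti (operator:999:3880114)
- 2026-08-31T09:28:46Z · REACTIVATED (open) — reconciler: reactivated — activity statement-checked at 2026-08-31T08:36:20Z after parking at 2026-08-22T13:09:41Z (operator:999:2653169)

sub-problem: FouriersLaw · status: open · opened planner-plancard-AtomisticToContinuum-Fourier-7928271c-g2-0 2026-08-15T18:56:23Z · rev 1 · ledger route-AtomisticToContinuum-PhononLorentzGas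
GENERATED by the gate from the ledger (D-0016/17). Provers cite these decls: `theorem foo : Summit.AtomisticToContinuum.FouriersLaw.Theses.PhononLorentzGas.<Decl> := …` in Summits/AtomisticToContinuum/FouriersLaw/Theorems/<Name>.lean.
-/

namespace Summit.AtomisticToContinuum.FouriersLaw.Theses.PhononLorentzGas

open scoped BigOperators Topology Manifold Classical MeasureTheory ProbabilityTheory Matrix InnerProductSpace ComplexConjugate ContinuousMap
open Filter Set Function TopologicalSpace MeasureTheory

attribute [summit_statement] _root_.FouriersLaw

/-- item stmt-AtomisticToContinuum-12792 · crux · rank 2 · open · by planner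
why it might fail: Hard quartic cell: large-amplitude states oscillate above the band top √(ω₂+4) with all harmonics and combination tones off the BOUNDED band, so exact breathers exist and Komech-type spectral spreading (unbounded continuum) is unavailable; a positive-measure sticky set kills mixing.
sources: JaksicPillet1998, doi:10.1007/s00205-006-0039-z, doi:10.1016/0031-8914(71)90068-1, arXiv:2510.20003, HairerMattingly2009, LanfordLebowitzLieb1977
[crux] ONE CONJUNCT CELL IN THE THERMAL HARMONIC LATTICE FIELD IS MIXING (card crux CellMixing;
shared in substance with GaussianiserCellTransfer's SingleCellMixing): for ω₂, lam, β > 0 and T > 0,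
for the infinite chain harmonicHostWithCell ω₂ lam β {0} on ℤ (pinning ω₂ q²/2 and unit harmonic
bonds everywhere, plus lam q₀⁴/4 at site 0 and β (q₁ − q₀)⁴/4 on the bond (0,1)), every
infinite-volume dynamics D preserving a TEMPERED (uniformly bounded second moments) Gibbs state μ at
temperature T has decaying time correlations ⟨F ; G∘Φ_t⟩_μ → 0 for all smooth local observables of
polynomial growth in every finite window Λ. [difficulty: XL] -/
@[route_item "route-AtomisticToContinuum-PhononLorentzGas"]
def CellMixing : Prop :=
  ∀ ω₂ lam β : ℝ, 0 < ω₂ → 0 < lam → 0 < β → ∀ T : ℝ, 0 < T → ∀ (D : (Literature.MathematicalPhysics.KineticTheory.HeatConduction.harmonicHostWithCell ω₂ lam β ({0} : Finset ℤ)).Dynamics) (μ : MeasureTheory.Measure Literature.MathematicalPhysics.KineticTheory.HeatConduction.ChainConfig), (Literature.MathematicalPhysics.KineticTheory.HeatConduction.harmonicHostWithCell ω₂ lam β ({0} : Finset ℤ)).IsGibbs T μ → (∃ C : ℝ, ∀ i : ℤ, MeasureTheory.Integrable (fun σ : Literature.MathematicalPhysics.KineticTheory.HeatConduction.ChainConfig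 => (σ i).1 ^ 2 + (σ i).2 ^ 2) μ ∧ ∫ σ, ((σ i).1 ^ 2 + (σ i).2 ^ 2) ∂μ ≤ C) → D.PreservesMeasure μ → ∀ Λ : Finset ℤ, D.HasCorrelationDecay μ Λ

/-- item stmt-AtomisticToContinuum-12793 · crux · rank 3 · open · by planner
why it might fail: No comparison principle for NESS currents of deterministic chains is known; the claim is false for small ℓ at high T (dense κ ~ T^(1/4) vs weak-link P_ℓ), hence ℓ₁(T); a proof by series decomposition at the shared cells presupposes that cells thermalise inside the DENSE chain too.
sources: Buttiker1986, BonettoLebowitzLukkarinen2004, DharLebowitz2008, Dhar2008, BonettoLebowitzReyBellet2000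
[crux] SUFFICIENTLY DILUTE PERIODIC DILUTIONS OF THE CONJUNCT CHAIN CONDUCT AT LEAST AS WELL (the
densification step, corrected from gen-1's CellMonotonicity): for all ω₂, lam, β, γ > 0 and T > 0
there is ℓ₁ such that for every ℓ ≥ ℓ₁ there is N₀ with: for N ≥ N₀, every finite-N response
coefficient D of the dense chain cellChain ω₂ lam β γ (fun _ => true) (= pinnedChain ω₂ lam β γ,
rfl) at temperature T and every response coefficient D' of the dilute chain P_ℓ = cellChain ω₂ lam β
γ (cellPeriodic ℓ) at the same N, T satisfy D ≤ D'. As N → ∞ it says κ(T) ≤ κ_ℓ(T) for ℓ ≥ ℓ₁(T),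
which the kinetic picture predicts with room to spare (κ_ℓ ≈ ℓ/r₁(T) → ∞); only the pair (dense,
P_ℓ) with ℓ large is claimed — no monotonicity in general cell sets, no fixed ℓ. [difficulty:
open-problem] -/
@[route_item "route-AtomisticToContinuum-PhononLorentzGas", crux]
def DilutionComparison : Prop :=
  ∀ ω₂ lam β γ : ℝ, 0 < ω₂ → 0 < lam → 0 < β → 0 < γ → ∀ T : ℝ, 0 < T → ∃ ℓ₁ : ℕ, ∀ ℓ : ℕ, ℓ₁ ≤ ℓ → ∃ N₀ : ℕ, ∀ N : ℕ, N₀ ≤ N → ∀ D D' : ℝ, (Literature.MathematicalPhysics.KineticTheory.HeatConduction.cellChain ω₂ lam β γ (fun _ => true)).IsResponseCoeff N T D → (Literature.MathematicalPhysics.KineticTheory.HeatConduction.cellChain ω₂ lam β γ (Literature.MathematicalPhysics.KineticTheory.HeatConduction.cellPeriodic ℓ)).IsResponseCoeff N T D' → D ≤ D'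

/-- item stmt-AtomisticToContinuum-12794 · crux · rank 4 · open · by planner
why it might fail: Inside the kinetic window (M ≤ M_T(ℓ) cells) it is a renewal theorem; for fixed ℓ and N → ∞ the residual inter-cell memory after the return time 2ℓ/v_max must not accumulate, band-edge tails of the lattice field decay only like t^(-1/2), and ℓ₀(T) → ∞ both as T → 0 and T → ∞.
sources: Gallavotti1969, Spohn1978, doi:10.1142/s0129055x0500242x, BricmontKupiainen2013, CuneoEckmannHairerReyBellet2018, HairerMajda2009
[crux] THE RUNG — PERIODIC DILUTE CELL CHAINS HAVE A WELL-DEFINED, N-UNIFORMLY BOUNDED RESPONSE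
(card items DiluteMarkovLimit + 'beyond the window'): for all ω₂, lam, β, γ > 0 and T > 0 there is
ℓ₀ such that for every ℓ ≥ ℓ₀ there are C and N₀ with: for all N ≥ N₀ the chain P_ℓ = cellChain ω₂
lam β γ (cellPeriodic ℓ) HAS a response coefficient at (N, T) (some weak-steady-state family over
the bath temperatures with a δ-limit of the total current: Cuneo–Eckmann–Hairer–Rey-Bellet existence
for the path network swept from the right bath + Hairer–Majda linear response, folded in) and EVERY
response coefficient D at (N, T) satisfies |D| ≤ C (expected D ≈ ℓ/r₁(T)·(1+o(1)), r₁ = (1−τ)/(τ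
c_∞) the single-cell excess resistance). [deps: CellMixing] [difficulty: XL] -/
@[route_item "route-AtomisticToContinuum-PhononLorentzGas", crux]
def DiluteBoundedResponse : Prop :=
  ∀ ω₂ lam β γ : ℝ, 0 < ω₂ → 0 < lam → 0 < β → 0 < γ → ∀ T : ℝ, 0 < T → ∃ ℓ₀ : ℕ, ∀ ℓ : ℕ, ℓ₀ ≤ ℓ → ∃ C : ℝ, ∃ N₀ : ℕ, ∀ N : ℕ, N₀ ≤ N → (∃ D : ℝ, (Literature.MathematicalPhysics.KineticTheory.HeatConduction.cellChain ω₂ lam β γ (Literature.MathematicalPhysics.KineticTheory.HeatConduction.cellPeriodic ℓ)).IsResponseCoeff N T D) ∧ ∀ D : ℝ, (Literature.MathematicalPhysics.KineticTheory.HeatConduction.cellChain ω₂ lam β γ (Literature.MathematicalPhysics.KineticTheory.HeatConduction.cellPeriodic ℓ)).IsResponseCoeff N T D → |D| ≤ C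

/-- item stmt-AtomisticToContinuum-0717 · support · rank 9 · closed · proved by Summit.AtomisticToContinuum.FouriersLaw.Theorems.FourierGreenKubo.finiteResponseOfUnique_holds (prover) · by planner
sources: ReyBellet2003, HairerMajda2009, CuneoEckmannHairerReyBellet2018
CONDITIONAL FORM OF 0705 (supersedes it as the prover target; refuters pool-5/g3-0: 0705 stand-alone
quantifies over EVERY steady-state family and is false-prone if weak steady states were non-unique):
assuming UNIQUENESS of weak steady states (IsSteadyState class) for pinnedChain at all N, T_L, T_R >
0, the finite-N linear-response limit D_N(T) = lim_{δ→0, δ≠0} totalCurrent(μ_{N,T+δ/2,T−δ/2})/δ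
exists for every T > 0 and N. Content: differentiability at equilibrium of NESS expectations of the
polynomial currents in the bath temperatures (ReyBellet2003 arXiv:math-ph/0303021 Rem 4.4 (51)–(56)
finite-volume Green–Kubo; HairerMajda2009 arXiv:0909.4313 Thm 2.3 framework — their SDE Thm 4.4
Assumption 5 fails here, so verify Assumptions 1–3 via CEHR2018 (2.5)/Carmona2007 Thm 1.1(iv)
weighted spectral gap). N = 0, 1: totalCurrent ≡ 0, D = 0. Together with 0706 gives 0705. -/
@[route_item "route-AtomisticToContinuum-PhononLorentzGas", crux]
def FiniteResponseOfUnique : Prop :=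
  ∀ ω₂ lam β γ : ℝ, 0 < ω₂ → 0 < lam → 0 < β → 0 < γ → (∀ (N : ℕ) (T_L T_R : ℝ), 0 < T_L → 0 < T_R → ∀ μ ν : MeasureTheory.Measure (Literature.MathematicalPhysics.KineticTheory.HeatConduction.PhaseSpace N), (Literature.MathematicalPhysics.KineticTheory.HeatConduction.pinnedChain ω₂ lam β γ).IsSteadyState N T_L T_R μ → (Literature.MathematicalPhysics.KineticTheory.HeatConduction.pinnedChain ω₂ lam β γ).IsSteadyState N T_L T_R ν → μ = ν) → ∀ μ : (N : ℕ) → ℝ → ℝ → MeasureTheory.Measure (Literature.MathematicalPhysics.KineticTheory.HeatConduction.PhaseSpace N), (∀ (N : ℕ) (T_L T_R : ℝ), 0 < T_L → 0 < T_R → (Literature.MathematicalPhysics.KineticTheory.HeatConduction.pinnedChain ω₂ lam β γ).IsSteadyState N T_L T_R (μ N T_L T_R)) → ∀ T : ℝ, 0 < T → ∀ N : ℕ, ∃ D : ℝ, Filter.Tendsto (fun δ : ℝ => (Literature.MathematicalPhysics.KineticTheory.HeatConduction.pinnedChain ω₂ lam β γ).totalCurrent (μ N (T + δ / 2) (T -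 δ / 2)) / δ) (nhdsWithin 0 {(0 : ℝ)}ᶜ) (nhds D)

/-- `FiniteResponseOfUnique` holds: proved by `Summit.AtomisticToContinuum.FouriersLaw.Theorems.FourierGreenKubo.finiteResponseOfUnique_holds`. -/
theorem FiniteResponseOfUnique_holds : FiniteResponseOfUnique := _root_.Summit.AtomisticToContinuum.FouriersLaw.Theorems.FourierGreenKubo.finiteResponseOfUnique_holds

/-- item stmt-AtomisticToContinuum-0741 · support · rank 9 · closed · proved by Summit.AtomisticToContinuum.FouriersLaw.Theorems.nessUnique_proof (prover) · by planner
sources: CuneoEckmannHairerReyBellet2018, Carmona2007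
[crux] UNIQUENESS OF THE WEAK STEADY STATE (the half of stmt-0706 not covered by the landed fact
Literature.MathematicalPhysics.KineticTheory.HeatConduction.CuneoEckmannHairerReyBellet2018_pinnedChain,
p3544): for pinnedChain ω₂ lam β γ (all > 0), every N and T_L, T_R > 0, any two measures in the weak
Fokker–Planck class IsSteadyState (probability, ∫ L f dμ = 0 for f ∈ C_c^∞, bond currents
integrable) coincide. Print: uniqueness of the INVARIANT MEASURE of the Langevin semigroup
(CuneoEckmannHairerReyBellet2018 Thm 2.13(1): C1, C2, CA; Carmona2007 Thm 1.1(iii)); the item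
additionally needs 'weak stationary probability solution of L*μ = 0 ⇒ P_t-invariant' for this
hypoelliptic L with cubic drift (Echeverría 1982 well-posed martingale problem on C_c^∞ +
non-explosion via e^{θH}; Bogachev–Krylov–Röckner–Shaposhnikov 2015 Ch. 5 is non-degenerate only) —
the FP-identification lemma is the formal crux. N = 0: PhaseSpace 0 is a point (unique probability
measure); N = 1: both baths on site 0, OU at temperature (T_L+T_R)/2. This is exactly the hypothesis
of FiniteResponse and ThermodynamicLimit and, with the fact, gives clause (i) of FouriersLawFor. -/
@[route_item "route-AtomisticToContinuum-PhononLorentzGas", crux]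
def NessUnique : Prop :=
  ∀ ω₂ lam β γ : ℝ, 0 < ω₂ → 0 < lam → 0 < β → 0 < γ → ∀ (N : ℕ) (T_L T_R : ℝ), 0 < T_L → 0 < T_R → ∀ μ ν : MeasureTheory.Measure (Literature.MathematicalPhysics.KineticTheory.HeatConduction.PhaseSpace N), (Literature.MathematicalPhysics.KineticTheory.HeatConduction.pinnedChain ω₂ lam β γ).IsSteadyState N T_L T_R μ → (Literature.MathematicalPhysics.KineticTheory.HeatConduction.pinnedChain ω₂ lam β γ).IsSteadyState N T_L T_R ν → μ = ν

/-- `NessUnique` holds: proved by `Summit.AtomisticToContinuum.FouriersLaw.Theorems.nessUnique_proof`. -/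
theorem NessUnique_holds : NessUnique := _root_.Summit.AtomisticToContinuum.FouriersLaw.Theorems.nessUnique_proof

/-- item stmt-AtomisticToContinuum-11071 · support · rank 9 · open · by planner
sources: BonettoLebowitzReyBellet2000, BonettoLebowitzLukkarinenOlla2009
[support] SHARED-WAYPOINT CONTENT, WRITTEN OUT (=
`Literature.Barriers.AtomisticToContinuum.HasBoundedResponse (pinnedChain ω₂ lam β γ)` for all
parameters > 0 — definiens verbatim; `hasBoundedResponse_iff` is `Iff.rfl`, so the old and the new
decl are definitionally equal: planner SketchIff.lean `example : New = Old := rfl`, rc 0): along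
EVERY steady-state family μ (IsSteadyState class, no uniqueness assumed) and every T > 0, if the
finite-N response limits D_N = lim_{δ→0, δ≠0} totalCurrent(μ_{N,T+δ/2,T−δ/2})/δ exist for all N,
then (|D_N|)_N is bounded — BLR2000 §6.3's missing 'dependence of D on L' in its weakest
quantitative form. In THIS route it is an OUTPUT (TransferToBoundedResponse 9655, candidate proof
attached) consumed by `closes`; open-problem as a standalone target. Cone repair 2026-08-15
(route-repair gen 2): the Barriers PREDICATE carries [cite] doc tags and no `_holds` (it is
vocabulary, explicit binder P), so the staffability audit (#h21_route_deps, D-0027 §2.1 amended)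
lists it as an unproved cite-only dependency (confirmed on sibling route OddSectorIrreversibility
rev 2→3, now staffable); unfolding removes the name from the decl cone without changing the stateme -/
@[route_item "route-AtomisticToContinuum-PhononLorentzGas"]
def BoundedResponse : Prop :=
  ∀ ω₂ lam β γ : ℝ, 0 < ω₂ → 0 < lam → 0 < β → 0 < γ → ∀ μ : (N : ℕ) → ℝ → ℝ → MeasureTheory.Measure (Literature.MathematicalPhysics.KineticTheory.HeatConduction.PhaseSpace N), (∀ (N : ℕ) (T_L T_R : ℝ), 0 < T_L → 0 < T_R → (Literature.MathematicalPhysics.KineticTheory.HeatConduction.pinnedChain ω₂ lam β γ).IsSteadyState N T_L T_R (μ N T_L T_R)) → ∀ T : ℝ, 0 < T → ∀ D : ℕ → ℝ, (∀ N : ℕ, Filter.Tendsto (fun δ : ℝ => (Literature.MathematicalPhysics.KineticTheory.HeatConduction.pinnedChain ω₂ lam β γ).totalCurrent (μ N (T + δ / 2) (T - δ / 2)) / δ) (nhdsWithin 0 {(0 : ℝ)}ᶜ) (nhds (D N))) → BddAbove (Set.range fun N => |D N|)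

/-- item stmt-AtomisticToContinuum-12795 · support · rank 9 · open · by planner
sources: LanfordLebowitzLieb1977, arXiv:2510.20003
[support] de-vacuifies CellMixing: for ω₂, lam, β > 0 and T > 0 the one-cell chain
harmonicHostWithCell ω₂ lam β {0} has a tempered Gibbs state at temperature T (uniformly bounded
second moments) carried by an infinite-volume dynamics that preserves it (Lanford–Lebowitz–Lieb 1977
Thm 3 for the site-dependent nearest-neighbour chain — printed in that generality, proved in tree
only for homogeneous chains — plus Thm 4 uniqueness in dimension one and invariance of the Gibbs
state). [difficulty: L] -/
@[route_item "route-AtomisticToContinuum-PhononLorentzGas"]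
def CellDynamicsExists : Prop :=
  ∀ ω₂ lam β : ℝ, 0 < ω₂ → 0 < lam → 0 < β → ∀ T : ℝ, 0 < T → ∃ μ : MeasureTheory.Measure Literature.MathematicalPhysics.KineticTheory.HeatConduction.ChainConfig, (Literature.MathematicalPhysics.KineticTheory.HeatConduction.harmonicHostWithCell ω₂ lam β ({0} : Finset ℤ)).IsGibbs T μ ∧ (∃ C : ℝ, ∀ i : ℤ, MeasureTheory.Integrable (fun σ : Literature.MathematicalPhysics.KineticTheory.HeatConduction.ChainConfig => (σ i).1 ^ 2 + (σ i).2 ^ 2) μ ∧ ∫ σ, ((σ i).1 ^ 2 + (σ i).2 ^ 2) ∂μ ≤ C) ∧ ∃ D : (Literature.MathematicalPhysics.KineticTheory.HeatConduction.harmonicHostWithCell ω₂ lam β ({0} : Finset ℤ)).Dynamics, D.PreservesMeasure μ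

/-- item stmt-AtomisticToContinuum-12796 · support · rank 9 · open · by planner
sources: BonettoLebowitzReyBellet2000
[support] GLUE OF THE LADDER, PROVED sorry-free by the planner (Sketch.lean `diluteToDense_holds`,
axioms propext / Classical.choice / Quot.sound; ~45 lines, copy into Theorems/):
DiluteBoundedResponse → DilutionComparison → NessUnique → PositiveOrInfiniteLimit → BoundedResponse
(the fourth hypothesis is the statement of item PositiveOrInfiniteLimit written out verbatim, so
that the decl elaborates wherever the gate renders it). Proof: each D N of a steady-state family of
pinnedChain is a response coefficient of cellChain … (fun _ => true) by rfl; with ℓ = max(ℓ₀, ℓ₁)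
the comparison and the rung give D N ≤ D' ≤ C for N ≥ max(N₀, N₀'); the slot gives D N → ℓ > 0 in
EReal, so D N ≥ 0 eventually; finitely many N are absorbed by a finite sum. [difficulty:
provable-now] -/
@[route_item "route-AtomisticToContinuum-PhononLorentzGas"]
def DiluteToDense : Prop :=
  DiluteBoundedResponse → DilutionComparison → NessUnique → (∀ ω₂ lam β γ : ℝ, 0 < ω₂ → 0 < lam → 0 < β → 0 < γ → (∀ (N : ℕ) (T_L T_R : ℝ), 0 < T_L → 0 < T_R → ∀ μ ν : MeasureTheory.Measure (Literature.MathematicalPhysics.KineticTheory.HeatConduction.PhaseSpace N), (Literature.MathematicalPhysics.KineticTheory.HeatConduction.pinnedChain ω₂ lam β γ).IsSteadyState N T_L T_R μ → (Literature.MathematicalPhysics.KineticTheory.HeatConduction.pinnedChain ω₂ lam β γ).IsSteadyState N T_L T_R ν → μ = ν) → ∀ μ : (N : ℕ) → ℝ → ℝ → MeasureTheory.Measure (Literature.MathematicalPhysics.KineticTheory.HeatConduction.PhaseSpace N), (∀ (N : ℕ) (T_L T_R : ℝ), 0 < T_L → 0 < T_R → (Literature.MathematicalPhysics.KineticTheory.HeatConduction.pinnedChain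 ω₂ lam β γ).IsSteadyState N T_L T_R (μ N T_L T_R)) → ∀ T : ℝ, 0 < T → ∀ D : ℕ → ℝ, (∀ N : ℕ, Filter.Tendsto (fun δ : ℝ => (Literature.MathematicalPhysics.KineticTheory.HeatConduction.pinnedChain ω₂ lam β γ).totalCurrent (μ N (T + δ / 2) (T - δ / 2)) / δ) (nhdsWithin 0 {(0 : ℝ)}ᶜ) (nhds (D N))) → ∃ ℓ : EReal, 0 < ℓ ∧ Filter.Tendsto (fun N : ℕ => ((D N : ℝ) : EReal)) Filter.atTop (nhds ℓ)) → BoundedResponse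

/-- item stmt-AtomisticToContinuum-9128 · support · rank 9 · open · by planner
sources: BonettoLebowitzReyBellet2000, Hammersley1988, CanestrariLiveraniOlla2026
[support] IMPORT SLOT (what this line does NOT supply: a lower bound and existence of the limit).
Under weak-NESS uniqueness, for every steady-state family, T > 0 and response coefficients D: D_N
converges in EReal to some ℓ ∈ (0, +∞]. NECESSARY for the conjunct (D_N → κ(T) > 0), so not too
strong; together with BoundedResponse it gives D_N → κ ∈ (0,∞). Suppliers: FeketeResistance minus
its crux (B) (QuasiSubadditiveResistance + PositiveConductance + Fekete on {N ≥ 2} give R_N/N → ℓ' ∈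
[0,∞), i.e. D_N → 1/ℓ' ∈ (0,+∞]); SuperadditiveJunction ((A)+(B)+(C) ⇒ real positive limit);
EscapeDeficit's bracket + EscapeNonOscillation. Dedup by signature will not catch those — the tenure
planner re-points the Assembly when one lands. Provers of THIS route should not start here.
[difficulty: L] -/
@[route_item "route-AtomisticToContinuum-PhononLorentzGas", crux]
def PositiveOrInfiniteLimit : Prop :=
  ∀ ω₂ lam β γ : ℝ, 0 < ω₂ → 0 < lam → 0 < β → 0 < γ → (∀ (N : ℕ) (T_L T_R : ℝ), 0 < T_L → 0 < T_R → ∀ μ ν : MeasureTheory.Measure (Literature.MathematicalPhysics.KineticTheory.HeatConduction.PhaseSpace N), (Literature.MathematicalPhysics.KineticTheory.HeatConduction.pinnedChain ω₂ lam β γ).IsSteadyState N T_L T_R μ → (Literature.MathematicalPhysics.KineticTheory.HeatConduction.pinnedChain ω₂ lam β γ).IsSteadyState N T_L T_R ν → μ = ν) → ∀ μ : (N : ℕ) → ℝ → ℝ → MeasureTheory.Measure (Literature.MathematicalPhysics.KineticTheory.HeatConduction.PhaseSpace N), (∀ (N : ℕ) (T_L T_R : ℝ), 0 < T_L → 0 <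 T_R → (Literature.MathematicalPhysics.KineticTheory.HeatConduction.pinnedChain ω₂ lam β γ).IsSteadyState N T_L T_R (μ N T_L T_R)) → ∀ T : ℝ, 0 < T → ∀ D : ℕ → ℝ, (∀ N : ℕ, Filter.Tendsto (fun δ : ℝ => (Literature.MathematicalPhysics.KineticTheory.HeatConduction.pinnedChain ω₂ lam β γ).totalCurrent (μ N (T + δ / 2) (T - δ / 2)) / δ) (nhdsWithin 0 {(0 : ℝ)}ᶜ) (nhds (D N))) → ∃ ℓ : EReal, 0 < ℓ ∧ Filter.Tendsto (fun N : ℕ => ((D N : ℝ) : EReal)) Filter.atTop (nhds ℓ)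

/-- item stmt-AtomisticToContinuum-9900 · support · rank 9 · closed · proved by Summit.AtomisticToContinuum.FouriersLaw.Theorems.pinnedSteadyStateExists_proof @ 192d41102e52 (prover) · by planner
sources: CuneoEckmannHairerReyBellet2018, Carmona2007
[support] CLAUSE (i) EXISTENCE FOR THE CONJUNCT'S CHAIN (route-repair 2026-08-15, cone bookkeeping;
provable now; kind support, rank 9): for pinnedChain ω₂ lam β γ with ω₂, lam, β, γ > 0, every N and
all T_L, T_R > 0 there is a weak (Fokker–Planck) steady state (OscillatorChain.IsSteadyState).
PROVED in tree:
Literature.MathematicalPhysics.KineticTheory.HeatConduction.pinnedChain_exists_isSteadyState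
(LangevinChainNESSHolds.lean; the discharged fact CuneoEckmannHairerReyBellet2018_pinnedChain for N
≥ 1 + OscillatorChain.isSteadyState_zero for N = 0) — a Theorems file importing the route file +
LangevinChainNESSHolds closes it in one line (evidence file attached:
PinnedSteadyStateExistsProof.lean, rc 0, axioms propext/Classical.choice/Quot.sound). WHY AN ITEM:
it lets the deciding theorem 'closes' take clause (i) existence as a hypothesis, so that the Theses
file can drop the import Literature.MathematicalPhysics.KineticTheory.LangevinChainNESSHolds
(≈55-module Langevin-SDE cone with the two undischarged Kolmogorov–Chentsov Hölder facts) — the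
pending route-repair edit (imports := [InfiniteChainDynamics], closes re-proved, Assembly restated;
package attached as evidence to the route -/
@[route_item "route-AtomisticToContinuum-PhononLorentzGas", crux]
def PinnedSteadyStateExists : Prop :=
  ∀ ω₂ lam β γ : ℝ, 0 < ω₂ → 0 < lam → 0 < β → 0 < γ → ∀ (N : ℕ) (T_L T_R : ℝ), 0 < T_L → 0 < T_R → ∃ μ : MeasureTheory.Measure (Literature.MathematicalPhysics.KineticTheory.HeatConduction.PhaseSpace N), (Literature.MathematicalPhysics.KineticTheory.HeatConduction.pinnedChain ω₂ lam β γ).IsSteadyState N T_L T_R μ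

/-- `PinnedSteadyStateExists` holds: proved by `Summit.AtomisticToContinuum.FouriersLaw.Theorems.pinnedSteadyStateExists_proof` @ 192d41102e52. -/
theorem PinnedSteadyStateExists_holds : PinnedSteadyStateExists := _root_.Summit.AtomisticToContinuum.FouriersLaw.Theorems.pinnedSteadyStateExists_proof

/-- item stmt-AtomisticToContinuum-12797 · assembly · rank 1 · open · by planner
sources: BonettoLebowitzReyBellet2000, CuneoEckmannHairerReyBellet2018
[assembly] DiluteBoundedResponse → DilutionComparison → NessUnique → FiniteResponseOfUnique →
PositiveOrInfiniteLimit → FouriersLaw (the type of `closes`). -/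
@[route_item "route-AtomisticToContinuum-PhononLorentzGas"]
def Assembly : Prop :=
  DiluteBoundedResponse → DilutionComparison → NessUnique → FiniteResponseOfUnique → PositiveOrInfiniteLimit → FouriersLaw

/-! D-0027 §2.1 — DECIDING THEOREM (planner-authored via `route open/edit --closes-file`; by planner-rrepair-AtomisticToContinuum-PhononLor-325acd35-g2-0 2026-08-15T19:54:08Z):
its hypotheses are this route's items and its conclusion the sub-problem Statement (glue_lint), and it elaborates with this file. -/

/-- D-0027 §2.1 DECIDING THEOREM of route PhononLorentzGas (card dilute-nonlinearity-phonon-lorentz-gas), rev 1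
(cone repair 2026-08-15): the rung `DiluteBoundedResponse`, the densification crux `DilutionComparison`, weak-NESS
uniqueness, existence of the response limits, the import slot (limit of `D_N` in `(0, +∞]`) and clause-(i)
existence `PinnedSteadyStateExists` (proved in tree as `pinnedChain_exists_isSteadyState`; an item so that the
Theses file imports only CellChain + HarmonicHostWithCell) decide the sub-problem Statement `FouriersLaw`.
Proof: Step 0 (= item `DiluteToDense`, inlined) gives bounded response of the dense chain — every `D N` of a
steady-state family of `pinnedChain` is a response coefficient of `cellChain … (fun _ => true)` by `rfl`, the
comparison and the rung bound it by `C` eventually, the slot makes it eventually nonnegative; clause (i) from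
`PinnedSteadyStateExists` + uniqueness; clause (ii): along the canonical family the EReal limit `ℓ ∈ (0,+∞]` of
`D_N` is `≤ sup |D_N| < ⊤`, hence real and positive =: `κ T`; uniqueness transfers the `δ`-limits to every
steady-state family. -/
@[closes "route-AtomisticToContinuum-PhononLorentzGas"] theorem closes (hDil : DiluteBoundedResponse) (hCmp : DilutionComparison) (hU : NessUnique)
    (hR : FiniteResponseOfUnique) (hL : PositiveOrInfiniteLimit) (hE : PinnedSteadyStateExists) :
    _root_.FouriersLaw := by
  -- Step 0 (the ladder's glue, = item DiluteToDense proved inline): bounded response of the dense chain.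
  have hB : BoundedResponse := by
    intro ω₂ lam β γ hω hl hβ hγ μ hμ T hT D hD
    have huniq := hU ω₂ lam β γ hω hl hβ hγ
    -- the ladder: response coefficients of the dense chain are eventually ≤ C
    obtain ⟨ℓ₀, hℓ₀⟩ := hDil ω₂ lam β γ hω hl hβ hγ T hT
    obtain ⟨ℓ₁, hℓ₁⟩ := hCmp ω₂ lam β γ hω hl hβ hγ T hT
    obtain ⟨C, N₁, hC⟩ := hℓ₀ (max ℓ₀ ℓ₁) (le_max_left _ _)
    obtain ⟨N₂, hN₂⟩ := hℓ₁ (max ℓ₀ ℓ₁) (le_max_right _ _)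
    -- each `D N` is a response coefficient of the dense cell chain (= pinnedChain, by `rfl`)
    have hresp : ∀ N : ℕ,
        (Literature.MathematicalPhysics.KineticTheory.HeatConduction.cellChain ω₂ lam β γ
          (fun _ => true)).IsResponseCoeff N T (D N) := fun N =>
      ⟨μ N, fun T_L T_R hL' hR' => hμ N T_L T_R hL' hR', hD N⟩
    have hupper : ∀ N : ℕ, max N₁ N₂ ≤ N → D N ≤ C := by
      intro N hN
      obtain ⟨⟨D', hD'⟩, hbound⟩ := hC N ((le_max_left _ _).trans hN)
      exact (hN₂ N ((le_max_right _ _).trans hN) (D N) D' (hresp N) hD').trans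
        ((le_abs_self D').trans (hbound D' hD'))
    -- the import slot: `D N → ℓ > 0` in EReal, so eventually `0 ≤ D N`
    obtain ⟨ℓ, hℓpos, hℓ⟩ := hL ω₂ lam β γ hω hl hβ hγ huniq μ hμ T hT D hD
    have hlower : ∀ᶠ N in Filter.atTop, 0 ≤ D N := by
      have h0 : ∀ᶠ N in Filter.atTop, ((0 : ℝ) : EReal) < ((D N : ℝ) : EReal) :=
        hℓ.eventually (eventually_gt_nhds (by exact_mod_cast hℓpos))
      exact h0.mono fun N hN => le_of_lt (EReal.coe_lt_coe_iff.1 hN)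
    obtain ⟨N₃, hN₃⟩ := Filter.eventually_atTop.1 hlower
    -- assemble: beyond max N₁ N₂ N₃ the bound is C, below it a finite sum of the |D n|
    set M : ℕ := max (max N₁ N₂) N₃ with hM
    refine ⟨max C (∑ n ∈ Finset.range M, |D n|), ?_⟩
    rintro _ ⟨N, rfl⟩
    show |D N| ≤ _
    by_cases hN : M ≤ N
    · have h1 : max N₁ N₂ ≤ N := (le_max_left _ _).trans hN
      have h2 : N₃ ≤ N := (le_max_right _ _).trans hN
      rw [abs_of_nonneg (hN₃ N h2)]
      exact (hupper N h1).trans (le_max_left _ _)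
    · push Not at hN
      exact (Finset.single_le_sum (f := fun n => |D n|) (fun n _ => abs_nonneg (D n))
        (Finset.mem_range.2 hN)).trans (le_max_right _ _)
  -- Fourier's law for the conjunct's chain
  show ∀ ω₂ lam β γ : ℝ, 0 < ω₂ → 0 < lam → 0 < β → 0 < γ →
    (Literature.MathematicalPhysics.KineticTheory.HeatConduction.pinnedChain ω₂ lam β γ).FouriersLawFor
  intro ω₂ lam β γ hω hl hβ hγ
  have huniq := hU ω₂ lam β γ hω hl hβ hγ
  -- clause (i): existence (item PinnedSteadyStateExists — the in-tree theorem
  -- `pinnedChain_exists_isSteadyState`, Cuneo–Eckmann–Hairer–Rey-Bellet 2018 Thm 2.13, taken as a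
  -- hypothesis so that this file imports no Langevin-SDE module) + uniqueness
  have hex : ∀ (N : ℕ) (T_L T_R : ℝ), 0 < T_L → 0 < T_R →
      ∃ μ : MeasureTheory.Measure (Literature.MathematicalPhysics.KineticTheory.HeatConduction.PhaseSpace N),
        (Literature.MathematicalPhysics.KineticTheory.HeatConduction.pinnedChain ω₂ lam β γ).IsSteadyState N T_L T_R μ :=
    fun N T_L T_R hL' hR' => hE ω₂ lam β γ hω hl hβ hγ N T_L T_R hL' hR'
  refine ⟨fun N T_L T_R hL' hR' => ?_, ?_⟩
  · obtain ⟨μ, hμ⟩ := hex N T_L T_R hL' hR'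
    exact ⟨μ, hμ, fun ν hν => huniq N T_L T_R hL' hR' ν μ hν hμ⟩
  -- clause (ii): the canonical family
  classical
  let μ₀ : (N : ℕ) → ℝ → ℝ →
      MeasureTheory.Measure (Literature.MathematicalPhysics.KineticTheory.HeatConduction.PhaseSpace N) :=
    fun N T_L T_R => if h : 0 < T_L ∧ 0 < T_R then Classical.choose (hex N T_L T_R h.1 h.2) else 0
  have hμ₀ : ∀ (N : ℕ) (T_L T_R : ℝ), 0 < T_L → 0 < T_R →
      (Literature.MathematicalPhysics.KineticTheory.HeatConduction.pinnedChain ω₂ lam β γ).IsSteadyState N T_L T_R (μ₀ N T_L T_R) := by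
    intro N T_L T_R hL' hR'
    simp only [μ₀, dif_pos (And.intro hL' hR')]
    exact Classical.choose_spec (hex N T_L T_R hL' hR')
  -- for every T > 0: response coefficients along μ₀, their positive-or-infinite limit, boundedness
  have key : ∀ T : ℝ, 0 < T → ∃ κT : ℝ, 0 < κT ∧ ∃ D : ℕ → ℝ,
      (∀ N : ℕ, Filter.Tendsto (fun δ : ℝ =>
        (Literature.MathematicalPhysics.KineticTheory.HeatConduction.pinnedChain ω₂ lam β γ).totalCurrent
          (μ₀ N (T + δ / 2) (T - δ / 2)) / δ) (nhdsWithin 0 {(0 : ℝ)}ᶜ) (nhds (D N))) ∧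
      Filter.Tendsto D Filter.atTop (nhds κT) := by
    intro T hT
    have hDex := hR ω₂ lam β γ hω hl hβ hγ huniq μ₀ hμ₀ T hT
    choose D hD using hDex
    obtain ⟨ℓ, hℓpos, hℓ⟩ := hL ω₂ lam β γ hω hl hβ hγ huniq μ₀ hμ₀ T hT D hD
    obtain ⟨S, hSub⟩ := hB ω₂ lam β γ hω hl hβ hγ μ₀ hμ₀ T hT D hD
    have hDle : ∀ N : ℕ, ((D N : ℝ) : EReal) ≤ ((S : ℝ) : EReal) := fun N =>
      EReal.coe_le_coe_iff.2 ((le_abs_self _).trans (hSub ⟨N, rfl⟩))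
    have hℓle : ℓ ≤ ((S : ℝ) : EReal) := le_of_tendsto' hℓ hDle
    have hℓtop : ℓ ≠ ⊤ := ne_top_of_le_ne_top (EReal.coe_ne_top S) hℓle
    have hℓbot : ℓ ≠ ⊥ := ne_bot_of_gt hℓpos
    have hcoe : ((ℓ.toReal : ℝ) : EReal) = ℓ := EReal.coe_toReal hℓtop hℓbot
    refine ⟨ℓ.toReal, ?_, D, hD, ?_⟩
    · have h0 : ((0 : ℝ) : EReal) < ((ℓ.toReal : ℝ) : EReal) := by
        rw [hcoe]; exact_mod_cast hℓpos
      exact EReal.coe_lt_coe_iff.1 h0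
    · have h' : Filter.Tendsto (fun N : ℕ => ((D N : ℝ) : EReal)) Filter.atTop
          (nhds ((ℓ.toReal : ℝ) : EReal)) := by
        rw [hcoe]; exact hℓ
      exact EReal.tendsto_coe.1 h'
  choose κf hκpos Df hDf hDlim using key
  refine ⟨fun T => if hT : 0 < T then κf T hT else 1, fun T hT => ?_, ?_⟩
  · simp only [dif_pos hT]; exact hκpos T hT
  intro μ hμ T hT
  refine ⟨Df T hT, fun N => ?_, ?_⟩
  · refine (hDf T hT N).congr' ?_
    have h2 : ∀ᶠ δ in nhds (0 : ℝ), δ < 2 * T := eventually_lt_nhds (by linarith)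
    have h2' : ∀ᶠ δ in nhds (0 : ℝ), -(2 * T) < δ := eventually_gt_nhds (by linarith)
    filter_upwards [mem_nhdsWithin_of_mem_nhds h2, mem_nhdsWithin_of_mem_nhds h2'] with δ hlt hgt
    have ha : 0 < T + δ / 2 := by linarith
    have hb : 0 < T - δ / 2 := by linarith
    rw [huniq N _ _ ha hb (μ₀ N _ _) (μ N _ _) (hμ₀ N _ _ ha hb) (hμ N _ _ ha hb)]
  · simp only [dif_pos hT]; exact hDlim T hT

end Summit.AtomisticToContinuum.FouriersLaw.Theses.PhononLorentzGas
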